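import Summits.AtomisticToContinuum.Crystallization.Theorems.ChartedZeroExcessLayeredLatticeLiouvilleZZR
import Summits.AtomisticToContinuum.Crystallization.Theorems.ChartedZeroExcessLayeredLatticeLiouvilleZZS
import Summits.AtomisticToContinuum.Crystallization.Theorems.ChartedZeroExcessLayeredLatticeLiouvilleZZT
import Summits.AtomisticToContinuum.Crystallization.Theorems.ChartedZeroExcessLayeredLatticeLiouvilleZZ

/-!
# Charted zero-excess layered lattices — Part ZZU: the (B′.5) SKELETON «X_Θ from the windows, modulo the metric riders»

Route `ChartedPlanarOrder`, station L2′, lineage `stmt-AtomisticToContinuum-26636`; critic rows 1487 (A) / 1488 /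
1490 (SKELETON-FIRST).  Imports tree ZZR (LEMMA Θ, index side), ZZS (normalisation), ZZT (pin extension), ZZ (link
maps from partners).

THE WINDOWS OF RECORD (`window S K Ψ lo hi = {z | Ψ z ∈ moatIn S K lo hi}`, distances to the container `K`):
partnered sites `A = window 8 (43/2)` (the whole moat: REG-out of the cool-shadow crystal), the mid window
`W = window (81/8) (155/8)` and the deep window `W′ = window (179/16) (293/16)`; one Barlow step moves an atom by
at most `βS ≤ 17/16`, so `W′`-links lie in `W`, `W`-links and 2-links lie in `A` (slack `51/16 = 3·17/16`).

THE METRIC RIDERS (named `Prop`s with the record dials; each is load-bearing — must-fail file):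
* R1 `WindowConnected S K Ψ τS` — `W` and `W′` are Barlow-path connected;
* R2-S `LayerCovered S K Ψ` — every site within `179/16` of `K` has, on each of the seven sheets `x.1 + j`,
  `|j| ≤ 3`, a deep-window site (the read sheets `Kread = {w.1 | w ∈ W′}` cover the pin zone three links deep
  and the inner ball);
* R2-C `ReadCovered S K D Ψ Φ ε` — both sheets `y.1, y.1 − 1` of every target-chart site within `27/2` of `K`
  carry the partner of a mid-window site (so they are READABLE after the normalisation of Part ZZS).

★★★ `slabIso_package`.  INPUT: the global S-chart `Ψ, τS` (onto `S`), S clean / separated / bond-gapped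
(`βS + 2ε ≤ 28/25`, `βS ≤ 17/16`); LEMMA C's interface for the target: a chart `Φ, τC, D` of `C`, separation and
bond gap, two-shell goodness with charted bonds within `27/2` of `K` (`hgoodC`), link closure within `21/2` of `K`
(`hlc`), partners for all moat atoms (`hout`); the pin-step dials (`hϑ … hhi`, `ε ≤ 1/40`); the container
`K ⊆ S`, finite, nonempty, `K ⊆ B̄(x₀, 4)` — SOURCE: (GL) `BondLabelP`'s own binders `K ⊆ S`,
`∀ k ∈ K, dist k x₀ ≤ q` with `q = 4`; finiteness of the sites charted within `43/2` of `K`; the riders R1, R2-S,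
R2-C.  OUTPUT = the `X_Θ` binder list of the general junction Part ZZP `exists_isBondLabel_of_slabIso` at
`(r, ℓ, RΘ, Rl) = (8, 43/2, 13, 21/2)`: a re-indexed chart `Φ″, τ″, D″` of `C` with link closure within `21/2`,
an injective `Θ` with `BarlowAdj τS x x' ↔ BarlowAdj τ″ (Θ x) (Θ x')` for `x.1 ∈ Kread`, partners
`Θ y ∈ D″, dist (Ψ y) (Φ″ (Θ y)) ≤ ε` on the moat within `13` of `K`, and `x.1 ∈ Kread` within `8` of `K`.

PROOF (no new estimate): partner map `g` (`hout`) ⇒ link maps on `W` and its links (Part ZZ) ⇒ normalised chart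
`σ, σ′, τ″, Rs` (Part ZZS, using R1) ⇒ slab isomorphism `Θ ⊇ σ ∘ g` on `W′` (Part ZZR, using R1) ⇒ `σ ∘ g = Θ`
on the moat within `1067/80` of `K` (Part ZZT `pin_extension_record`: finite set from `hfin`, goodness from
`hgoodC`, the container `N = {y | y.1 ∈ Kread}` from R2-S, readability of partners from R2-C, the known band
`(179/16, 1067/80] ⊂ W′`) ⇒ the six outputs (link closure of `D″` transported through the ONE-SIDED clause 2 of
Part ZZS plus R2-C).  ★ `slabIso_package_of_empty`: the degenerate container `K = ∅` (empty moat, `Θ = id`).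
-/

noncomputable section
open scoped RealInnerProductSpace
open Literature.Geometry.DiscreteGeometry (IsTwoShellGoodSet)

namespace Summit.AtomisticToContinuum.Crystallization.Theorems.ChartedZeroExcessLayeredLatticeLiouville

open Summit.AtomisticToContinuum.Crystallization.Theorems.ChartedPlanarOrderRigidityDoor (E3)

/-! ## Windows -/

/-- ★ the WINDOW of chart sites whose atoms lie in the moat `moatIn S K lo hi` (`lo < d(Ψ z, K) < hi`). -/
def window (S K : Set E3) (Ψ : ℤ × ℤ × ℤ → E3) (lo hi : ℝ) : Set (ℤ × ℤ × ℤ) :=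
  {z | Ψ z ∈ moatIn S K lo hi}

/-- Membership in `window` unfolds to membership of `Ψ z` in the moat (lane docstring, hand-2 g39). -/
theorem mem_window {S K : Set E3} {Ψ : ℤ × ℤ × ℤ → E3} {lo hi : ℝ} {z : ℤ × ℤ × ℤ} :
    z ∈ window S K Ψ lo hi ↔ Ψ z ∈ moatIn S K lo hi := Iff.rfl

/-- moats are monotone in both dials (UG `moatIn_mono` / `moatIn_anti` combined). -/
theorem moatIn_mono₂ {S K : Set E3} {r₁ ℓ₁ r₂ ℓ₂ : ℝ} (hr : r₂ ≤ r₁) (hℓ : ℓ₁ ≤ ℓ₂) :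
    moatIn S K r₁ ℓ₁ ⊆ moatIn S K r₂ ℓ₂ := by
  rintro p ⟨hpS, ⟨y, hy, hyl⟩, hfar⟩
  exact ⟨hpS, ⟨y, hy, by linarith⟩, fun y' hy' => by linarith [hfar y' hy']⟩

/-- one step of length `≤ b` moves the moat dials by `b`. -/
theorem mem_moatIn_of_step {S K : Set E3} {r ℓ b : ℝ} {p p' : E3} (hp : p ∈ moatIn S K r ℓ)
    (hp' : p' ∈ S) (hd : dist p p' ≤ b) : p' ∈ moatIn S K (r - b) (ℓ + b) := by
  obtain ⟨-, ⟨y, hy, hyl⟩, hfar⟩ := hp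
  refine ⟨hp', ⟨y, hy, ?_⟩, fun y' hy' => ?_⟩
  · have h1 : dist p' y ≤ dist p' p + dist p y := dist_triangle _ _ _
    rw [dist_comm p' p] at h1
    linarith
  · have h1 := hfar y' hy'
    have h2 : dist p y' ≤ dist p p' + dist p' y' := dist_triangle _ _ _
    linarith

/-- a Barlow step of the global S-chart has length `≤ βS`. -/
theorem dist_le_of_barlowAdj {S : Set E3} {Ψ : ℤ × ℤ × ℤ → E3} {τ : ℤ → Bool} {βS : ℝ}
    (hΨ : IsBarlowBondChart S Set.univ Ψ τ) (hgapS : ∀ p ∈ S, ∀ p' ∈ S, IsBond p p' → dist p p' ≤ βS)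
    {x z : ℤ × ℤ × ℤ} (h : BarlowAdj τ x z) : dist (Ψ x) (Ψ z) ≤ βS :=
  hgapS _ (hΨ.2.1 (Set.mem_univ _)) _ (hΨ.2.1 (Set.mem_univ _))
    ((hΨ.2.2 x (Set.mem_univ _) z (Set.mem_univ _)).2 h)

/-- ★ WINDOW STEP: a Barlow neighbour of a `window lo hi` site lies in `window (lo − 17/16) (hi + 17/16)`. -/
theorem mem_window_of_barlowAdj {S K : Set E3} {Ψ : ℤ × ℤ × ℤ → E3} {τ : ℤ → Bool} {βS lo hi : ℝ}
    (hΨ : IsBarlowBondChart S Set.univ Ψ τ) (hgapS : ∀ p ∈ S, ∀ p' ∈ S, IsBond p p' → dist p p' ≤ βS)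
    (hβS' : βS ≤ 17 / 16) {x z : ℤ × ℤ × ℤ} (hx : x ∈ window S K Ψ lo hi) (h : BarlowAdj τ x z) :
    z ∈ window S K Ψ (lo - 17 / 16) (hi + 17 / 16) :=
  mem_moatIn_of_step hx (hΨ.2.1 (Set.mem_univ _)) ((dist_le_of_barlowAdj hΨ hgapS h).trans hβS')

/-! ## The metric riders (record dials) -/

/-- ★ RIDER R1 «WINDOW CONNECTIVITY»: the mid window `W = window (81/8) (155/8)` and the deep window
`W′ = window (179/16) (293/16)` are each connected under Barlow steps inside themselves.
OPEN (metric rider, to be proved in a later part).  Why it might fail: a Barlow path between two atoms of the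
shell `{lo < d(·, K) < hi}` must stay inside the shell — possible only because the shell is thick (`hi − lo ≥ 57/8`,
many bond lengths) while `d(Ψ ·, K)` moves by `≤ 17/16` per step; a pinched shell (width `< 2` bonds) or a
container `K` far from round could disconnect a thin shell, which the record widths exclude but the proof must
quantify (outward/inward steering: ZZD `exists_atom_toward`, tangential steering inside a sheet).  Sources: ZZD
`exists_atom_toward`, ZZE cone lemmas, UG `moatIn`; [this file, g81]. -/
def WindowConnected (S K : Set E3) (Ψ : ℤ × ℤ × ℤ → E3) (τS : ℤ → Bool) : Prop :=
  (∀ y ∈ window S K Ψ (81 / 8) (155 / 8), ∀ x ∈ window S K Ψ (81 / 8) (155 / 8),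
    Relation.ReflTransGen
      (fun a b => a ∈ window S K Ψ (81 / 8) (155 / 8) ∧ b ∈ window S K Ψ (81 / 8) (155 / 8) ∧ BarlowAdj τS a b)
      y x) ∧
  ∀ y ∈ window S K Ψ (179 / 16) (293 / 16), ∀ x ∈ window S K Ψ (179 / 16) (293 / 16),
    Relation.ReflTransGen
      (fun a b => a ∈ window S K Ψ (179 / 16) (293 / 16) ∧ b ∈ window S K Ψ (179 / 16) (293 / 16) ∧
        BarlowAdj τS a b) y x

/-- ★ RIDER R2-S «LAYER COVERAGE»: every chart site within `179/16` of the container has, on each of the seven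
sheets `x.1 + j` (`|j| ≤ 3`), a deep-window site.
OPEN (metric rider).  Why it might fail: it needs every S-sheet within three sheets of an atom near `K` to REACH the
deep shell: climb `|j|` links (`≤ 51/16`), then walk inside the sheet (six in-sheet links at every site) —
`d(Ψ ·, K)` is `17/16`-Lipschitz along links and unbounded along the (infinite, injectively charted, locally
finite) sheet, so it crosses the window of width `57/8 > 17/16`; would fail only for a window thinner than one
bond.  Sources: ZV `linkPt` / `barlowAdj_linkPt`, ZZL `linkPt_fst_bounds`, UG `moatIn`; [this file, g81]. -/
def LayerCovered (S K : Set E3) (Ψ : ℤ × ℤ × ℤ → E3) : Prop :=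
  ∀ x : ℤ × ℤ × ℤ, (∃ k ∈ K, dist (Ψ x) k ≤ 179 / 16) → ∀ j : ℤ, -3 ≤ j → j ≤ 3 →
    ∃ w ∈ window S K Ψ (179 / 16) (293 / 16), w.1 = x.1 + j

/-- ★ RIDER R2-C «READ COVERAGE»: both sheets `y.1`, `y.1 − 1` of every target-chart site within `27/2` of the
container carry the partner atom of some mid-window site.
OPEN (metric rider).  Why it might fail: by REG-in every target atom `c` with `10 < d(c, K) < 43/2` has an S-atom
within `ε`, whose (unique) partner is `c`; so it suffices that each of the two C-sheets has a charted atom with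
`d ∈ (81/8 + ε, 155/8 − ε)` — an in-sheet walk as for R2-S inside LEMMA C's charted zone; fails if LEMMA C's
chart domain `D` does not contain whole sheet patches out to `d = 155/8` (its zone must reach `43/2 + 2`).
Sources: YZ `IsCoolShadowCrystal` (REG-in), LEMMA C interface (critic row 1452); [this file, g81]. -/
def ReadCovered (S K : Set E3) (D : Set (ℤ × ℤ × ℤ)) (Ψ Φ : ℤ × ℤ × ℤ → E3) (ε : ℝ) : Prop :=
  ∀ y ∈ D, (∃ k ∈ K, dist (Φ y) k < 27 / 2) → ∀ m : ℤ, (m = y.1 ∨ m = y.1 - 1) →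
    ∃ z ∈ window S K Ψ (81 / 8) (155 / 8), ∃ y' ∈ D, dist (Ψ z) (Φ y') ≤ ε ∧ (y'.1 = m ∨ y'.1 - 1 = m)

/-! ## The skeleton -/

/-- the partner map of the moat (a choice function for `hout`). -/
theorem exists_partnerMap {S K : Set E3} {D : Set (ℤ × ℤ × ℤ)} {Φ : ℤ × ℤ × ℤ → E3} {ε : ℝ}
    (hout : ∀ p ∈ moatIn S K 8 (43 / 2), ∃ y ∈ D, dist p (Φ y) ≤ ε) (Ψ : ℤ × ℤ × ℤ → E3) :
    ∃ g : ℤ × ℤ × ℤ → ℤ × ℤ × ℤ, ∀ z ∈ window S K Ψ 8 (43 / 2), g z ∈ D ∧ dist (Ψ z) (Φ (g z)) ≤ ε := by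
  classical
  refine ⟨fun z => if h : Ψ z ∈ moatIn S K 8 (43 / 2) then (hout _ h).choose else z, fun z hz => ?_⟩
  have hz' : Ψ z ∈ moatIn S K 8 (43 / 2) := hz
  simp only [dif_pos hz']
  obtain ⟨h1, h2⟩ := (hout _ hz').choose_spec
  exact ⟨h1, h2⟩

/-- ★★★ **THE (B′.5) SKELETON.**  See the module docstring: from the windows, LEMMA C's interface and the three
metric riders to the `X_Θ` binders of Part ZZP `exists_isBondLabel_of_slabIso` at `(r, ℓ, RΘ, Rl) = (8, 43/2, 13, 21/2)`. -/
theorem slabIso_package {S C K : Set E3} {D : Set (ℤ × ℤ × ℤ)} {Ψ Φ : ℤ × ℤ × ℤ → E3} {τS τC : ℤ → Bool}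
    {ε δS βS δC βC ϑ aLo aHi : ℝ} {x₀ : E3}
    (hΨ : IsBarlowBondChart S Set.univ Ψ τS) (hsurjΨ : ∀ p ∈ S, ∃ x, Ψ x = p)
    (hclean : ∀ p ∈ S, IsTwoShellGoodSet (1 / 16) (9 / 10) 1 S p)
    (hsepS : ∀ p ∈ S, ∀ p' ∈ S, p ≠ p' → δS ≤ dist p p') (hεS : 2 * ε < δS)
    (hgapS : ∀ p ∈ S, ∀ p' ∈ S, IsBond p p' → dist p p' ≤ βS) (hβS : βS + 2 * ε ≤ 28 / 25)
    (hβS' : βS ≤ 17 / 16)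
    (hΦ : IsBarlowBondChart C D Φ τC)
    (hsepC : ∀ c ∈ C, ∀ c' ∈ C, c ≠ c' → δC ≤ dist c c') (hεC : 2 * ε < δC)
    (hgapC : ∀ c ∈ C, ∀ c' ∈ C, IsBond c c' → dist c c' ≤ βC) (hβC : βC + 2 * ε ≤ 28 / 25)
    (hϑ : 0 ≤ ϑ) (haLo : 0 < aLo) (hbond : aHi * (1 + 2 * ϑ) ≤ 28 / 25)
    (hlo : aHi * (1 + ϑ) + 2 * ε < 9 / 10 * (Real.sqrt 2 - 1 / 16))
    (hlo' : 28 / 25 + 2 * ε < 9 / 10 * (Real.sqrt 2 - 1 / 16))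
    (hhi : 1 * (Real.sqrt 2 + 1 / 16) + 2 * ε ≤ 3 / 2 * aLo) (hε : ε ≤ 1 / 40)
    (hlc : ∀ y ∈ D, (∃ k ∈ K, dist (Φ y) k < 21 / 2) → ∀ y' : ℤ × ℤ × ℤ, BarlowAdj τC y y' → y' ∈ D)
    (hgoodC : ∀ y ∈ D, (∃ k ∈ K, dist (Φ y) k < 27 / 2) →
      IsTwoShellGoodSet ϑ aLo aHi C (Φ y) ∧ ∀ n ∈ C, IsBond (Φ y) n → ∃ y' ∈ D, Φ y' = n)
    (hKS : K ⊆ S) (hKfin : K.Finite) (hKne : K.Nonempty) (hK : ∀ k ∈ K, dist k x₀ ≤ 4)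
    (hout : ∀ p ∈ moatIn S K 8 (43 / 2), ∃ y ∈ D, dist p (Φ y) ≤ ε)
    (hfin : Set.Finite {x : ℤ × ℤ × ℤ | ∃ k ∈ K, dist (Ψ x) k ≤ 43 / 2})
    (hR1 : WindowConnected S K Ψ τS) (hR2S : LayerCovered S K Ψ) (hR2C : ReadCovered S K D Ψ Φ ε) :
    ∃ (Θ : ℤ × ℤ × ℤ → ℤ × ℤ × ℤ) (Kread : Set ℤ) (Φ'' : ℤ × ℤ × ℤ → E3) (τ'' : ℤ → Bool)
      (D'' : Set (ℤ × ℤ × ℤ)),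
      IsBarlowBondChart C D'' Φ'' τ'' ∧
      (∀ y ∈ D'', (∃ k ∈ K, dist (Φ'' y) k < 21 / 2) → ∀ y' : ℤ × ℤ × ℤ, BarlowAdj τ'' y y' → y' ∈ D'') ∧
      Function.Injective Θ ∧
      (∀ x x' : ℤ × ℤ × ℤ, x.1 ∈ Kread → (BarlowAdj τS x x' ↔ BarlowAdj τ'' (Θ x) (Θ x'))) ∧
      (∀ y : ℤ × ℤ × ℤ, Ψ y ∈ moatIn S K 8 (43 / 2) → (∃ k ∈ K, dist (Ψ y) k < 13) →
        Θ y ∈ D'' ∧ dist (Ψ y) (Φ'' (Θ y)) ≤ ε) ∧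
      (∀ x : ℤ × ℤ × ℤ, (∃ k ∈ K, dist (Ψ x) k ≤ 8) → x.1 ∈ Kread) := by
  classical
  -- ### partners on the whole moat `A = window 8 (43/2)`
  obtain ⟨g, hA⟩ := exists_partnerMap hout Ψ
  have puniq : ∀ (z y₁ y₂ : ℤ × ℤ × ℤ), y₁ ∈ D → y₂ ∈ D → dist (Ψ z) (Φ y₁) ≤ ε →
      dist (Ψ z) (Φ y₂) ≤ ε → y₁ = y₂ := by
    intro z y₁ y₂ h₁ h₂ d₁ d₂
    by_contra hne
    have hne' : Φ y₁ ≠ Φ y₂ := fun h => hne (hΦ.1 h₁ h₂ h)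
    have hsep := hsepC _ (hΦ.2.1 h₁) _ (hΦ.2.1 h₂) hne'
    have htri : dist (Φ y₁) (Φ y₂) ≤ dist (Φ y₁) (Ψ z) + dist (Ψ z) (Φ y₂) := dist_triangle _ _ _
    rw [dist_comm (Φ y₁) (Ψ z)] at htri
    linarith
  -- ### window inclusions (one Barlow step ≤ 17/16)
  have hW'W : window S K Ψ (179 / 16) (293 / 16) ⊆ window S K Ψ (81 / 8) (155 / 8) := fun z hz =>
    moatIn_mono₂ (by norm_num) (by norm_num) hz
  have hWA : window S K Ψ (81 / 8) (155 / 8) ⊆ window S K Ψ 8 (43 / 2) := fun z hz =>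
    moatIn_mono₂ (by norm_num) (by norm_num) hz
  have hW'1 : ∀ z ∈ window S K Ψ (179 / 16) (293 / 16), ∀ i, linkPt τS z i ∈ window S K Ψ (81 / 8) (155 / 8) :=
    fun z hz i => moatIn_mono₂ (by norm_num) (by norm_num)
      (mem_window_of_barlowAdj hΨ hgapS hβS' hz (barlowAdj_linkPt τS z i))
  have hW1 : ∀ z ∈ window S K Ψ (81 / 8) (155 / 8), ∀ i, linkPt τS z i ∈ window S K Ψ (145 / 16) (327 / 16) :=
    fun z hz i => moatIn_mono₂ (by norm_num) (by norm_num)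
      (mem_window_of_barlowAdj hΨ hgapS hβS' hz (barlowAdj_linkPt τS z i))
  have hW1A : ∀ z ∈ window S K Ψ (81 / 8) (155 / 8), ∀ i, linkPt τS z i ∈ window S K Ψ 8 (43 / 2) :=
    fun z hz i => moatIn_mono₂ (by norm_num) (by norm_num) (hW1 z hz i)
  have hW2A : ∀ z ∈ window S K Ψ (81 / 8) (155 / 8), ∀ i j,
      linkPt τS (linkPt τS z i) j ∈ window S K Ψ 8 (43 / 2) :=
    fun z hz i j => moatIn_mono₂ (by norm_num) (by norm_num)
      (mem_window_of_barlowAdj hΨ hgapS hβS' (hW1 z hz i) (barlowAdj_linkPt τS _ j))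
  -- ### link maps on the mid window (Part ZZ)
  obtain ⟨hmaps, hnb⟩ := isLinkMap_window_of_partners hΨ hΦ hsepS hεS hgapS hβS hsepC hεC hgapC hβC
    hA hWA hW1A hW2A
  -- ### a base point of the deep window (R2-S at a container atom)
  obtain ⟨k₀, hk₀⟩ := hKne
  obtain ⟨x₁, hx₁⟩ := hsurjΨ k₀ (hKS hk₀)
  obtain ⟨y, hy, -⟩ := hR2S x₁ ⟨k₀, hk₀, by rw [hx₁, dist_self]; norm_num⟩ 0 (by norm_num) (by norm_num)
  -- ### normalisation (Part ZZS, rider R1)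
  obtain ⟨σ, σ', τ'', Rs, h1, h2, hiff, hRs, hchart, hpar, hW2, -⟩ :=
    exists_normalised_chart' hΦ hmaps hnb hW'W hW'1 hy (fun x hx => hR1.1 y (hW'W hy) x hx)
      (fun x hx => hR1.2 y hy x hx)
  -- ### the slab isomorphism (Part ZZR, rider R1)
  obtain ⟨Θ, hΘinj, -, -, hΘW, hΘiso, hΘls⟩ :=
    exists_slabIso (W := window S K Ψ (179 / 16) (293 / 16)) (fun x hx => (hW2 x hx).1)
      (fun x hx => (hW2 x hx).2) hy (fun x hx => hR1.2 y hy x hx)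
  -- ### readability of target sheets near the container (rider R2-C + partner uniqueness + ZZS clause 3)
  have readable : ∀ y' ∈ D, (∃ k ∈ K, dist (Φ y') k < 27 / 2) → y'.1 ∈ Rs ∧ y'.1 - 1 ∈ Rs := by
    intro y' hy'D hk
    have key : ∀ m : ℤ, (m = y'.1 ∨ m = y'.1 - 1) → m ∈ Rs := by
      intro m hm
      obtain ⟨z, hzW, y'', hy''D, hd, hm'⟩ := hR2C y' hy'D hk m hm
      obtain ⟨hgzD, hgz⟩ := hA z (hWA hzW)
      have he : g z = y'' := puniq z (g z) y'' hgzD hy''D hgz hd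
      refine hRs m ⟨z, hzW, ?_⟩
      rw [he]
      exact hm'
    exact ⟨key _ (Or.inl rfl), key _ (Or.inr rfl)⟩
  -- ### distance bookkeeping: the atom of `K` attaining `d(p, K)`
  have hKne' : K.Nonempty := ⟨k₀, hk₀⟩
  have attain : ∀ p : E3, ∃ k ∈ K, Metric.infDist p K = dist p k := fun p =>
    hKfin.isCompact.exists_infDist_eq_dist hKne' p
  -- ### the inputs of the pin extension (Part ZZT) for `g'' = σ ∘ g`, chart `Φ ∘ σ'` on `D''`
  have hA'' : ∀ x, Ψ x ∈ moatIn S K 8 (43 / 2) → Metric.infDist (Ψ x) K ≤ 1067 / 80 →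
      (σ ∘ g) x ∈ {y' : ℤ × ℤ × ℤ | σ' y' ∈ D ∧ (σ' y').1 ∈ Rs ∧ (σ' y').1 - 1 ∈ Rs} ∧
        dist (Ψ x) ((Φ ∘ σ') ((σ ∘ g) x)) ≤ ε := by
    intro x hx hd
    obtain ⟨hgD, hgd⟩ := hA x hx
    obtain ⟨k, hk, he⟩ := attain (Ψ x)
    have hk' : dist (Φ (g x)) k < 27 / 2 := by
      have := dist_triangle (Φ (g x)) (Ψ x) k
      rw [dist_comm (Φ (g x)) (Ψ x)] at this
      linarith
    refine ⟨?_, by rw [hpar x]; exact hgd⟩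
    show σ' (σ (g x)) ∈ D ∧ (σ' (σ (g x))).1 ∈ Rs ∧ (σ' (σ (g x))).1 - 1 ∈ Rs
    rw [h1]
    exact ⟨hgD, readable (g x) hgD ⟨k, hk, hk'⟩⟩
  have hknown : ∀ x, Ψ x ∈ moatIn S K 8 (43 / 2) → 179 / 16 < Metric.infDist (Ψ x) K →
      Metric.infDist (Ψ x) K ≤ 1067 / 80 → (σ ∘ g) x = Θ x := by
    intro x hx hlo'' hhi''
    have hxW' : x ∈ window S K Ψ (179 / 16) (293 / 16) := by
      refine ⟨hx.1, (Metric.infDist_lt_iff hKne').1 (by linarith), fun k hk => ?_⟩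
      exact lt_of_lt_of_le hlo'' (Metric.infDist_le_dist_of_mem hk)
    exact ((hΘW x hxW').1).symm
  have hT : ∀ x, Ψ x ∈ moatIn S K 8 (43 / 2) → Metric.infDist (Ψ x) K ≤ 179 / 16 → x ∈ hfin.toFinset := by
    intro x hx hd
    obtain ⟨k, hk, he⟩ := attain (Ψ x)
    exact hfin.mem_toFinset.2 ⟨k, hk, by rw [← he]; linarith⟩
  have hgood'' : ∀ x, Ψ x ∈ moatIn S K 8 (43 / 2) → Metric.infDist (Ψ x) K ≤ 179 / 16 →
      IsTwoShellGoodSet ϑ aLo aHi C ((Φ ∘ σ') ((σ ∘ g) x)) ∧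
        ∀ n ∈ C, IsBond ((Φ ∘ σ') ((σ ∘ g) x)) n →
          ∃ y' ∈ {y' : ℤ × ℤ × ℤ | σ' y' ∈ D ∧ (σ' y').1 ∈ Rs ∧ (σ' y').1 - 1 ∈ Rs}, (Φ ∘ σ') y' = n := by
    intro x hx hd
    obtain ⟨hgD, hgd⟩ := hA x hx
    obtain ⟨k, hk, he⟩ := attain (Ψ x)
    have hk' : dist (Φ (g x)) k ≤ 179 / 16 + ε := by
      have := dist_triangle (Φ (g x)) (Ψ x) k
      rw [dist_comm (Φ (g x)) (Ψ x)] at this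
      linarith
    obtain ⟨hgood, hcov⟩ := hgoodC (g x) hgD ⟨k, hk, by linarith⟩
    rw [hpar x]
    refine ⟨hgood, fun n hn hb => ?_⟩
    obtain ⟨y', hy'D, hy'n⟩ := hcov n hn hb
    have hbd : dist (Φ (g x)) (Φ y') ≤ 28 / 25 := by rw [hy'n]; exact hb.2
    have hk'' : dist (Φ y') k < 27 / 2 := by
      have := dist_triangle (Φ y') (Φ (g x)) k
      rw [dist_comm (Φ y') (Φ (g x))] at this
      linarith
    refine ⟨σ y', ?_, by simp [Function.comp, h1, hy'n]⟩
    show σ' (σ y') ∈ D ∧ (σ' (σ y')).1 ∈ Rs ∧ (σ' (σ y')).1 - 1 ∈ Rs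
    rw [h1]
    exact ⟨hy'D, readable y' hy'D ⟨k, hk, hk''⟩⟩
  -- layer coverage three links deep (rider R2-S)
  have cover3 : ∀ x : ℤ × ℤ × ℤ, (∃ k ∈ K, dist (Ψ x) k ≤ 179 / 16) → ∀ p : ℤ × ℤ × ℤ,
      x.1 - 3 ≤ p.1 → p.1 ≤ x.1 + 3 →
        p.1 ∈ {k : ℤ | ∃ w ∈ window S K Ψ (179 / 16) (293 / 16), w.1 = k} := by
    intro x hx p hlo'' hhi''
    obtain ⟨w, hw, hw1⟩ := hR2S x hx (p.1 - x.1) (by omega) (by omega)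
    exact ⟨w, hw, by rw [hw1]; omega⟩
  have hN : ∀ x, Ψ x ∈ moatIn S K 8 (43 / 2) → Metric.infDist (Ψ x) K ≤ 179 / 16 →
      (∀ i, linkPt τS x i ∈ {y : ℤ × ℤ × ℤ | y.1 ∈ {k : ℤ | ∃ w ∈ window S K Ψ (179 / 16) (293 / 16), w.1 = k}}) ∧
      (∀ i j, linkPt τS (linkPt τS x i) j ∈
        {y : ℤ × ℤ × ℤ | y.1 ∈ {k : ℤ | ∃ w ∈ window S K Ψ (179 / 16) (293 / 16), w.1 = k}}) ∧
      ∀ i j l, linkPt τS (linkPt τS (linkPt τS x i) j) l ∈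
        {y : ℤ × ℤ × ℤ | y.1 ∈ {k : ℤ | ∃ w ∈ window S K Ψ (179 / 16) (293 / 16), w.1 = k}} := by
    intro x hx hd
    obtain ⟨k, hk, he⟩ := attain (Ψ x)
    have hxk : ∃ k ∈ K, dist (Ψ x) k ≤ 179 / 16 := ⟨k, hk, by rw [← he]; exact hd⟩
    have b1 := fun i => linkPt_fst_bounds τS x i
    have b2 := fun i j => linkPt_fst_bounds τS (linkPt τS x i) j
    have b3 := fun i j l => linkPt_fst_bounds τS (linkPt τS (linkPt τS x i) j) l
    refine ⟨fun i => cover3 x hxk _ ?_ ?_, fun i j => cover3 x hxk _ ?_ ?_, fun i j l => cover3 x hxk _ ?_ ?_⟩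
    · linarith [(b1 i).1]
    · linarith [(b1 i).2]
    · linarith [(b1 i).1, (b2 i j).1]
    · linarith [(b1 i).2, (b2 i j).2]
    · linarith [(b1 i).1, (b2 i j).1, (b3 i j l).1]
    · linarith [(b1 i).2, (b2 i j).2, (b3 i j l).2]
  -- ### the pin extension (Part ZZT): `σ ∘ g = Θ` on the moat within `1067/80` of `K`
  have hpin := pin_extension_record (N := {y : ℤ × ℤ × ℤ | y.1 ∈ {k : ℤ | ∃ w ∈ window S K Ψ (179 / 16) (293 / 16), w.1 = k}})
    hfin.toFinset hΨ hclean hsepS hεS hgapS hβS hchart hϑ haLo hbond hlo hlo' hhi hKfin hKne' hK hA'' hknown hT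
    hgood'' hN (fun y y' hy => hΘiso y y' hy) (fun y _ v hv => hΘls y v hv)
  -- ### the six outputs
  refine ⟨Θ, {k : ℤ | ∃ w ∈ window S K Ψ (179 / 16) (293 / 16), w.1 = k}, Φ ∘ σ', τ'',
    {y' : ℤ × ℤ × ℤ | σ' y' ∈ D ∧ (σ' y').1 ∈ Rs ∧ (σ' y').1 - 1 ∈ Rs}, hchart, ?_, hΘinj, hΘiso, ?_, ?_⟩
  · -- link closure of `D''` within `21/2` of `K`: ONE-SIDED transport (Part ZZS clause 2) + `hlc` + R2-C
    rintro y ⟨hyD, hyR, hyR'⟩ ⟨k, hk, hdk⟩ y' hadj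
    have hadjC : BarlowAdj τC (σ' y) (σ' y') := (hiff (σ' y) (σ' y') hyR hyR').1 (by rwa [h2, h2])
    have hy'D : σ' y' ∈ D := hlc (σ' y) hyD ⟨k, hk, hdk⟩ (σ' y') hadjC
    have hb : IsBond (Φ (σ' y)) (Φ (σ' y')) := (hΦ.2.2 (σ' y) hyD (σ' y') hy'D).2 hadjC
    have hk' : dist (Φ (σ' y')) k < 27 / 2 := by
      have := dist_triangle (Φ (σ' y')) (Φ (σ' y)) k
      have h' : dist ((Φ ∘ σ') y) k = dist (Φ (σ' y)) k := rfl
      rw [dist_comm (Φ (σ' y')) (Φ (σ' y))] at this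
      linarith [hb.2]
    exact ⟨hy'D, readable (σ' y') hy'D ⟨k, hk, hk'⟩⟩
  · -- partners within `13` of `K`
    rintro x hx ⟨k, hk, hdk⟩
    have hd : Metric.infDist (Ψ x) K ≤ 1067 / 80 := (Metric.infDist_le_dist_of_mem hk).trans (by linarith)
    obtain ⟨hD, hdist⟩ := hA'' x hx hd
    rw [hpin x hx hd] at hD hdist
    exact ⟨hD, hdist⟩
  · -- inner sites lie in read sheets (rider R2-S, `j = 0`)
    rintro x ⟨k, hk, hdk⟩
    obtain ⟨w, hw, hw1⟩ := hR2S x ⟨k, hk, by linarith⟩ 0 (by norm_num) (by norm_num)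
    exact ⟨w, hw, by rw [hw1]; ring⟩

/-- ★ the degenerate container `K = ∅`: the moat is empty and the original chart with `Θ = id` is a package. -/
theorem slabIso_package_of_empty {S C : Set E3} {D : Set (ℤ × ℤ × ℤ)} {Ψ Φ : ℤ × ℤ × ℤ → E3}
    {τS τC : ℤ → Bool} {ε : ℝ} (hΦ : IsBarlowBondChart C D Φ τC) :
    ∃ (Θ : ℤ × ℤ × ℤ → ℤ × ℤ × ℤ) (Kread : Set ℤ) (Φ'' : ℤ × ℤ × ℤ → E3) (τ'' : ℤ → Bool)
      (D'' : Set (ℤ × ℤ × ℤ)),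
      IsBarlowBondChart C D'' Φ'' τ'' ∧
      (∀ y ∈ D'', (∃ k ∈ (∅ : Set E3), dist (Φ'' y) k < 21 / 2) → ∀ y' : ℤ × ℤ × ℤ,
        BarlowAdj τ'' y y' → y' ∈ D'') ∧
      Function.Injective Θ ∧
      (∀ x x' : ℤ × ℤ × ℤ, x.1 ∈ Kread → (BarlowAdj τS x x' ↔ BarlowAdj τ'' (Θ x) (Θ x'))) ∧
      (∀ y : ℤ × ℤ × ℤ, Ψ y ∈ moatIn S (∅ : Set E3) 8 (43 / 2) → (∃ k ∈ (∅ : Set E3), dist (Ψ y) k < 13) →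
        Θ y ∈ D'' ∧ dist (Ψ y) (Φ'' (Θ y)) ≤ ε) ∧
      (∀ x : ℤ × ℤ × ℤ, (∃ k ∈ (∅ : Set E3), dist (Ψ x) k ≤ 8) → x.1 ∈ Kread) :=
  ⟨id, ∅, Φ, τC, D, hΦ, fun _ _ ⟨_, hk, _⟩ => (Set.notMem_empty _ hk).elim, fun _ _ h => h,
    fun _ _ hx => (Set.notMem_empty _ hx).elim, fun _ _ ⟨_, hk, _⟩ => (Set.notMem_empty _ hk).elim,
    fun _ ⟨_, hk, _⟩ => (Set.notMem_empty _ hk).elim⟩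

end Summit.AtomisticToContinuum.Crystallization.Theorems.ChartedZeroExcessLayeredLatticeLiouville

end
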